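import Summits.ResolutionOfSingularities.KangarooAtlas.MizutaniNumber
import Literature.RingTheory.MvPolynomial.Directrix
import Mathlib.LinearAlgebra.Matrix.NonsingularInverse
import Mathlib.LinearAlgebra.Matrix.ToLin
import HarnessLib

/-!
# Projective coordinate changes: Oda's invariant additive forms, the exponent and `dim B(𝔭)` are `GL_{n+1}(k)`-equivariant

Cell `pub-rosobs`, Mizutani enclosure (seat mizutani-encloser-2, gen 8). AI-written; AI review is weaker than expert review;
NOT a resolution-of-singularities theorem (summit relevance C).

Mizutani (Nagoya Math. J. 52 (1973) p. 87) calls two pairs `(V, W)`, `(V', W')` «of the same TYPE when there exist a field automorphism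
`σ` of `k` and a `k^q`-semi-linear isomorphism `ψ : W → W'` such that `σ ⊗ ψ` sends `V` onto `V'`» — Thm. 2.8's second part is a statement
about types.  In the tree's vocabulary (Oda 1983-II p. 1168 taken as DEFINITION: `invForms k p 𝔭 e = (L_B)_e(𝔭)`, `ExponentLE`, `hsDimAt`,
`exponent`, `hsDim` of a homogeneous prime `𝔭 ⊂ S = k[X_0, …, X_n]`) a linear change of the homogeneous coordinates of `ℙ^n_k` is the
`k`-algebra endomorphism `σ_M : X_j ↦ Σ_i M_{ji} X_i` of `S` (`M ∈ GL_{n+1}(k)`), and this file proves that every object of the dictionary is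
EQUIVARIANT under it — so that «type» is a projective invariant and the theorems about the explicit points `GenAtt.attP`, `ratPoint` apply to
all their projective transforms (`MizutaniExtremalIff.lean`):

* `aeval_linForm_addForm` — `σ_M (Σ_j a_j X_j^{q}) = Σ_i (Σ_j M_{ji}^{q} a_j) X_i^{q}` (`q = p^e`): on coefficient vectors `σ_M` acts by
  `a ↦ a ᵥ* M^{[q]}` (`Matrix.vecMul`, entrywise `q`-th powers);
* **`mem_invForms_comap_iff`** / `invForms_comap_eq` — `a ∈ (L_B)_e(σ_M^{-1} 𝔭) ↔ a ᵥ* M^{[q]} ∈ (L_B)_e(𝔭)` for EVERY ideal `𝔭` and every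
  matrix `M` (the coefficient differential operators are `k^{q}`-linear and the entries of `M^{[q]}` lie in `k^{q}`);
* for `M` invertible: `finrank_invForms_comap`, **`exponentLE_comap_iff`**, **`exponent_comap`**, `hsDimAt_comap`, **`hsDim_comap`** — the
  dimensions `dim_k (L_B)_e`, the exponent and `dim B(𝔭)` are invariant (`vecMul_frobVec`: `F^m` commutes with the twisted actions).

## References

* H. Mizutani, *Hironaka's additive group schemes*, Nagoya Math. J. 52 (1973) 85–95, p. 87 (the type of a pair `(V, W)`), Thm. 2.8.
  [Mizutani1973HironakaGroupSchemes]
* T. Oda, *Hironaka's additive group scheme, II*, Publ. RIMS 19 (1983), §2 (p. 1168: `L_B`, the exponent, `dim B`). [Oda1983HironakaGroupSchemeII]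
-/

noncomputable section

open MvPolynomial Literature.AlgebraicGeometry.Resolution Literature.AlgebraicGeometry.Resolution.HironakaScheme
open Literature.RingTheory.MvPolynomial

namespace Summit.ResolutionOfSingularities.KangarooAtlas.Mizutani

universe u

section CoordChange

variable (k : Type u) [Field k] (p : ℕ) [hp : Fact p.Prime] [CharP k p] {n : ℕ}
  (M : Matrix (Fin (n + 1)) (Fin (n + 1)) k)

/-! ### The substitution on additive forms -/

/-- `(Σ_i M_{ji} X_i)^{q} = Σ_i M_{ji}^{q} X_i^{q}` in characteristic `p` (`q = p^e`). [folklore] -/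
theorem linForm_pow_char_pow (e : ℕ) (v : Fin (n + 1) → k) :
    (linForm v) ^ p ^ e = ∑ i, C (v i ^ p ^ e) * (X i : MvPolynomial (Fin (n + 1)) k) ^ p ^ e := by
  haveI : ExpChar (MvPolynomial (Fin (n + 1)) k) p := ExpChar.prime hp.out
  rw [linForm_apply, sum_pow_char_pow]
  refine Finset.sum_congr rfl fun i _ => ?_
  rw [smul_eq_C_mul, mul_pow, ← map_pow]

/-- **`σ_M` ON ADDITIVE FORMS**: `σ_M (Σ_j a_j X_j^{q}) = Σ_i (Σ_j a_j M_{ji}^{q}) X_i^{q}`, i.e. `σ_M (addForm e a) = addForm e (a ᵥ* M^{[q]})`.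
[cite: Oda1983HironakaGroupSchemeII, §2 (p. 1168: the purely inseparable forms L_e)] -/
theorem aeval_linForm_addForm (e : ℕ) (a : Fin (n + 1) → k) :
    aeval (fun j => linForm (M j)) (addForm k p e a) =
      addForm k p e (Matrix.vecMul a (M.map fun x => x ^ p ^ e)) := by
  unfold addForm
  rw [map_sum]
  simp_rw [map_mul, map_pow, aeval_C, aeval_X, MvPolynomial.algebraMap_eq, linForm_pow_char_pow, Finset.mul_sum]
  rw [Finset.sum_comm]
  refine Finset.sum_congr rfl fun i _ => ?_
  rw [Matrix.vecMul, dotProduct, map_sum, Finset.sum_mul]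
  refine Finset.sum_congr rfl fun j _ => ?_
  rw [Matrix.map_apply, map_mul, mul_assoc]

/-- The entries of `M^{[q]}` are `q`-th powers: `a ᵥ* M^{[q]}` commutes with every `k^{q}`-linear `D`:
`D (Σ_j a_j M_{ji}^q) = Σ_j D(a_j) M_{ji}^q`. [folklore] -/
theorem apply_vecMul_map_pow (e : ℕ) (D : k →ₗ[frobPow k p e] k) (a : Fin (n + 1) → k) (i : Fin (n + 1)) :
    D (Matrix.vecMul a (M.map fun x => x ^ p ^ e) i) = Matrix.vecMul (fun j => D (a j)) (M.map fun x => x ^ p ^ e) i := by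
  simp only [Matrix.vecMul, dotProduct, Matrix.map_apply, map_sum]
  refine Finset.sum_congr rfl fun j _ => ?_
  have hmem : M j i ^ p ^ e ∈ frobPow k p e := pow_mem_frobPow e (M j i)
  have h := D.map_smul (⟨M j i ^ p ^ e, hmem⟩ : frobPow k p e) (a j)
  rw [Subfield.smul_def, Subfield.smul_def, smul_eq_mul, smul_eq_mul] at h
  simp only at h
  rw [mul_comm, h, mul_comm]

/-! ### Equivariance of the invariant forms -/

/-- **EQUIVARIANCE OF `(L_B)_e`**: for every ideal `𝔭` and every matrix `M`, `a ∈ (L_B)_e(σ_M^{-1}(𝔭))` iff `a ᵥ* M^{[p^e]} ∈ (L_B)_e(𝔭)`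
(`σ_M^{-1}(𝔭) = Ideal.comap σ_M 𝔭`). [cite: Oda1983HironakaGroupSchemeII, §2 (p. 1168: L_B = {f ∈ L : Df ∈ 𝔭 for all coefficient differential operators D})] -/
theorem mem_invForms_comap_iff (𝔭 : Ideal (MvPolynomial (Fin (n + 1)) k)) (e : ℕ) (a : Fin (n + 1) → k) :
    a ∈ invForms k p (𝔭.comap (aeval fun j => linForm (M j))) e ↔
      Matrix.vecMul a (M.map fun x => x ^ p ^ e) ∈ invForms k p 𝔭 e := by
  rw [mem_invForms_iff, mem_invForms_iff]
  refine forall₂_congr fun D hD => ?_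
  rw [Ideal.mem_comap, aeval_linForm_addForm]
  have h : Matrix.vecMul (fun j => D (a j)) (M.map fun x => x ^ p ^ e) =
      fun i => D (Matrix.vecMul a (M.map fun x => x ^ p ^ e) i) :=
    funext fun i => (apply_vecMul_map_pow k p M e D a i).symm
  rw [h]

/-- The same as an equality of `k`-subspaces: `(L_B)_e(σ_M^{-1} 𝔭) = (M^{[q]})^*((L_B)_e(𝔭))` (pull-back along `a ↦ a ᵥ* M^{[q]}`). [cite: Oda1983HironakaGroupSchemeII, §2 (p. 1168)] -/
theorem invForms_comap_eq (𝔭 : Ideal (MvPolynomial (Fin (n + 1)) k)) (e : ℕ) :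
    invForms k p (𝔭.comap (aeval fun j => linForm (M j))) e =
      (invForms k p 𝔭 e).comap (Matrix.vecMulLinear (M.map fun x => x ^ p ^ e)) := by
  ext a
  rw [mem_invForms_comap_iff, Submodule.mem_comap]
  rfl

/-- `F^m` commutes with the twisted actions: `(a ᵥ* M^{[p^e]})^{[p^m]} = a^{[p^m]} ᵥ* M^{[p^{e+m}]}`. [folklore] -/
theorem frobVec_vecMul (e m : ℕ) (a : Fin (n + 1) → k) :
    frobVec k p m (Matrix.vecMul a (M.map fun x => x ^ p ^ e)) =
      Matrix.vecMul (frobVec k p m a) (M.map fun x => x ^ p ^ (e + m)) := by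
  haveI : ExpChar k p := ExpChar.prime hp.out
  funext i
  simp only [frobVec, Matrix.vecMul, dotProduct, Matrix.map_apply]
  rw [sum_pow_char_pow]
  refine Finset.sum_congr rfl fun j _ => ?_
  rw [mul_pow, ← pow_mul, ← pow_add]

variable {M}

/-- For `M` invertible, `M^{[q]}` is invertible (`det M^{[q]} = (det M)^q`). [folklore] -/
theorem isUnit_det_map_pow (hM : IsUnit M.det) (e : ℕ) : IsUnit (M.map fun x => x ^ p ^ e).det := by
  have h : (M.map fun x => x ^ p ^ e) = (iterateFrobenius k p e).mapMatrix M := by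
    ext i j; rw [RingHom.mapMatrix_apply, Matrix.map_apply, Matrix.map_apply, iterateFrobenius_def]
  rw [h, ← RingHom.map_det]
  exact hM.map _

/-- The twisted action `a ↦ a ᵥ* M^{[q]}` as a `k`-linear automorphism of `k^{n+1}` (for `M` invertible). [folklore] -/
theorem bijective_vecMulLinear_map_pow (hM : IsUnit M.det) (e : ℕ) :
    Function.Bijective (Matrix.vecMulLinear (R := k) (M.map fun x => x ^ p ^ e)) := by
  have hU : IsUnit (M.map fun x => x ^ p ^ e) := (Matrix.isUnit_iff_isUnit_det _).mpr (isUnit_det_map_pow k p hM e)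
  exact ⟨Matrix.vecMul_injective_iff_isUnit.mpr hU, Matrix.vecMul_surjective_iff_isUnit.mpr hU⟩

/-- **`dim_k (L_B)_e` is a projective invariant.** [cite: Oda1983HironakaGroupSchemeII, §2 (p. 1168)] -/
theorem finrank_invForms_comap (hM : IsUnit M.det) (𝔭 : Ideal (MvPolynomial (Fin (n + 1)) k)) (e : ℕ) :
    Module.finrank k (invForms k p (𝔭.comap (aeval fun j => linForm (M j))) e) = Module.finrank k (invForms k p 𝔭 e) := by
  set T := LinearEquiv.ofBijective _ (bijective_vecMulLinear_map_pow k p hM e) with hT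
  have h : invForms k p (𝔭.comap (aeval fun j => linForm (M j))) e =
      (invForms k p 𝔭 e).comap (T : (Fin (n + 1) → k) →ₗ[k] (Fin (n + 1) → k)) := by
    rw [invForms_comap_eq]; rfl
  rw [h, Submodule.comap_equiv_eq_map_symm]
  exact LinearEquiv.finrank_map_eq _ _

/-- Pulling back commutes with `span_k F^m(·)` along the twisted actions (for `M` invertible). [folklore] -/
theorem comap_span_frobVec_image (hM : IsUnit M.det) (e m : ℕ) (N : Submodule k (Fin (n + 1) → k)) :
    (Submodule.span k (frobVec k p m '' (N : Set (Fin (n + 1) → k)))).comap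
        (Matrix.vecMulLinear (M.map fun x => x ^ p ^ (e + m))) =
      Submodule.span k (frobVec k p m ''
        (N.comap (Matrix.vecMulLinear (M.map fun x => x ^ p ^ e)) : Set (Fin (n + 1) → k))) := by
  set T := LinearEquiv.ofBijective _ (bijective_vecMulLinear_map_pow k p hM e) with hT
  set T' := LinearEquiv.ofBijective _ (bijective_vecMulLinear_map_pow k p hM (e + m)) with hT'
  -- the commutation `F^m ∘ T = T' ∘ F^m` on vectors
  have hcomm : ∀ a, frobVec k p m (T a) = T' (frobVec k p m a) := fun a => frobVec_vecMul k p M e m a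
  have hcomm' : ∀ b, frobVec k p m (T.symm b) = T'.symm (frobVec k p m b) := fun b => by
    apply T'.injective
    rw [← hcomm, LinearEquiv.apply_symm_apply, LinearEquiv.apply_symm_apply]
  change (Submodule.span k _).comap (T' : (Fin (n + 1) → k) →ₗ[k] (Fin (n + 1) → k)) =
    Submodule.span k (frobVec k p m ''
      (N.comap (T : (Fin (n + 1) → k) →ₗ[k] (Fin (n + 1) → k)) : Set (Fin (n + 1) → k)))
  rw [Submodule.comap_equiv_eq_map_symm, Submodule.comap_equiv_eq_map_symm, Submodule.map_span, Submodule.map_coe,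
    ← Set.image_comp, ← Set.image_comp]
  congr 1
  ext b
  simp only [Set.mem_image, Function.comp_apply, LinearEquiv.coe_coe]
  constructor
  · rintro ⟨a, ha, rfl⟩
    exact ⟨a, ha, hcomm' a⟩
  · rintro ⟨a, ha, rfl⟩
    exact ⟨a, ha, (hcomm' a).symm⟩

/-- **THE EXPONENT CONDITION IS A PROJECTIVE INVARIANT**: `exponent(B(σ_M^{-1}𝔭)) ≤ e ↔ exponent(B(𝔭)) ≤ e` for `M` invertible.
[cite: Oda1983HironakaGroupSchemeII, §2 (p. 1168: kF^{j−e}(L_B)_e = (L_B)_j)] -/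
theorem exponentLE_comap_iff (hM : IsUnit M.det) (𝔭 : Ideal (MvPolynomial (Fin (n + 1)) k)) (e : ℕ) :
    ExponentLE k p (𝔭.comap (aeval fun j => linForm (M j))) e ↔ ExponentLE k p 𝔭 e := by
  have hinj : ∀ j, Function.Injective (Submodule.comap (Matrix.vecMulLinear (R := k) (M.map fun x => x ^ p ^ j))) :=
    fun j => Submodule.comap_injective_of_surjective (bijective_vecMulLinear_map_pow k p hM j).2
  refine forall₂_congr fun j hj => ?_
  obtain ⟨m, rfl⟩ := Nat.exists_eq_add_of_le hj
  rw [Nat.add_sub_cancel_left, invForms_comap_eq, invForms_comap_eq, ← comap_span_frobVec_image k p hM e m]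
  exact (hinj (e + m)).eq_iff

/-- **THE EXPONENT IS A PROJECTIVE INVARIANT**: `exponent B(σ_M^{-1}𝔭) = exponent B(𝔭)`. [cite: Mizutani1973HironakaGroupSchemes, §1 (c) (the exponent e(Q))] -/
theorem exponent_comap (hM : IsUnit M.det) (𝔭 : Ideal (MvPolynomial (Fin (n + 1)) k)) :
    exponent k p (𝔭.comap (aeval fun j => linForm (M j))) = exponent k p 𝔭 := by
  unfold exponent
  congr 1
  ext e
  exact exponentLE_comap_iff k p hM 𝔭 e

/-- `hsDimAt` (`= n + 1 − dim (L_B)_e`, Oda's `dim B(𝔭)` read at level `e`) is a projective invariant. [cite: Oda1983HironakaGroupSchemeII, §2 (p. 1168)] -/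
theorem hsDimAt_comap (hM : IsUnit M.det) (𝔭 : Ideal (MvPolynomial (Fin (n + 1)) k)) (e : ℕ) :
    hsDimAt k p (𝔭.comap (aeval fun j => linForm (M j))) e = hsDimAt k p 𝔭 e := by
  unfold hsDimAt
  rw [finrank_invForms_comap k p hM]

/-- **`dim B(𝔭)` IS A PROJECTIVE INVARIANT**: `hsDim (σ_M^{-1}𝔭) = hsDim 𝔭`. [cite: Mizutani1973HironakaGroupSchemes, Thm. 1.3 (dim B = dim_k L_e/N_e)] -/
theorem hsDim_comap (hM : IsUnit M.det) (𝔭 : Ideal (MvPolynomial (Fin (n + 1)) k)) :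
    hsDim k p (𝔭.comap (aeval fun j => linForm (M j))) = hsDim k p 𝔭 := by
  unfold hsDim
  rw [exponent_comap k p hM, hsDimAt_comap k p hM]

end CoordChange

end Summit.ResolutionOfSingularities.KangarooAtlas.Mizutani

end
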